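import Summits.QuantumFields.YangMills.Theorems.SmallCircleAnchorAnchorGapStubDebyeScreening21

/-!
# Crux `AnchorGap` (stmt-QuantumFields-11141), line `registered` — the bond-weighted Debye–Hückel Gaussian (M-a(s) under stub X₀)

Matrix form of `…StubDebyeScreening21`: the precision matrix `P_w` of the Debye–Hückel Gaussian
with hopping weights `w(x,i) ∈ [0,1]` on the bonds `{x, x+eᵢ}` (diagonal `ε + 2d` kept), written
inline with Kronecker deltas as in `…StubDebyeScreening11`:

* `weightedDhMatrix_mulVec`, `weightedDhMatrix_posDef`, `weightedDhMatrix_inv_decay` — action,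
  positivity, and the covariance decay `|P_w⁻¹((x,a),(y,a'))| ≤ (g²/b₀)(2d/(2d+b₀))^n`, uniform in
  the period and the weights;
* `dhMatrix_blockInterpolate_eq_weighted` — for a set `T` of sites and `s ∈ ℝ`, the interpolated
  matrix `P_bd + s(P − P_bd)` of the decoupling step (`gaussian_decoupling_step`, coordinates
  `S = T × Fin k`) applied to the Debye–Hückel matrix `P` IS the weighted matrix with `w = 1` on
  bonds inside `T` or inside `Tᶜ` and `w = s` on bonds crossing `∂T`.

Hence every Gaussian met in the decoupling expansion about the Debye–Hückel reference has the
same exponentially decaying covariance bound.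
-/

set_option autoImplicit false

noncomputable section

namespace Summit.QuantumFields.YangMills.Theorems.AnchorGap

open MeasureTheory Finset Matrix
open Literature.Probability.LatticeModels

/-- **Action of the bond-weighted Debye–Hückel precision matrix.** With bond weights `w(x,i)`
on `{x, x+eᵢ}` the matrix `P_w = g⁻²[(ε + 2d + B) ⊗ δ − w-weighted hopping]` on `(ℤ/N)^d × Fin k`
acts by `(P_w φ)(x,a) = g⁻²[(ε + 2d)φ(x,a) + Σ_{a'} B_{aa'}φ(x,a') − Σ_i (w(x,i)φ(x+eᵢ,a) + w(x−eᵢ,i)φ(x−eᵢ,a))]`.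
[folklore] -/
theorem weightedDhMatrix_mulVec :
    ∀ (d N k : ℕ) [NeZero N] (g ε : ℝ) (B : Fin k → Fin k → ℝ) (wt : TorusSite d N → Fin d → ℝ) (φ : LatticeSineGordon.Config d N k) (p : TorusSite d N × Fin k), (Matrix.of (fun p q : TorusSite d N × Fin k => (g ^ 2)⁻¹ * ((if p.1 = q.1 then (if p.2 = q.2 then ε + 2 * (d : ℝ) else 0) + B p.2 q.2 else 0) - (if p.2 = q.2 then ∑ i : Fin d, ((if q.1 = p.1 + Pi.single i 1 then wt p.1 i else 0) + (if q.1 = p.1 - Pi.single i 1 then wt (p.1 - Pi.single i 1) i else 0)) else 0))) *ᵥ φ) p = (g ^ 2)⁻¹ * ((ε + 2 * d) * φ p + ∑ a' : Fin k, B p.2 a' * φ (p.1, a') - ∑ i : Fin d, (wt p.1 i * φ (p.1 + Pi.single i 1, p.2) + wt (p.1 - Pi.single i 1) i * φ (p.1 - Pi.single i 1, p.2))) := by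
  intro d N k _ g ε B wt φ p
  classical
  simp only [Matrix.mulVec, dotProduct, Matrix.of_apply]
  simp_rw [mul_assoc]
  rw [← Finset.mul_sum]
  congr 1
  simp only [sub_mul, Finset.sum_sub_distrib]
  congr 1
  · -- diagonal-in-`x` part
    rw [Fintype.sum_prod_type]
    simp only [ite_mul, zero_mul, Finset.sum_ite_irrel, Finset.sum_const_zero, Finset.sum_ite_eq,
      Finset.mem_univ, if_true, add_mul, Finset.sum_add_distrib]
  · -- hopping part
    rw [Fintype.sum_prod_type]
    simp only [ite_mul, zero_mul, sum_ite_eq, mem_univ, ↓reduceIte]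
    simp_rw [Finset.sum_mul]
    rw [Finset.sum_comm]
    refine Finset.sum_congr rfl fun i _ => ?_
    simp only [add_mul, Finset.sum_add_distrib, ite_mul, zero_mul, sum_ite_eq', mem_univ, ↓reduceIte]

/-- **The bond-weighted Debye–Hückel precision matrix is positive definite** for `g ≠ 0`,
`ε ≥ 0`, a symmetric mass matrix `B ≥ b₀ > 0` and weights `0 ≤ w ≤ 1`: it is symmetric (the
weight of the bond `{x, x+eᵢ}` appears in both entries) and `φᵀP_wφ ≥ g⁻² b₀ |φ|²`
(`weightedDebyeOp_coercive`). [folklore] -/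
theorem weightedDhMatrix_posDef :
    ∀ (d N k : ℕ) [NeZero N] (g ε b₀ : ℝ), g ≠ 0 → 0 ≤ ε → 0 < b₀ → ∀ (B : Fin k → Fin k → ℝ), (∀ a a' : Fin k, B a a' = B a' a) → (∀ w : Fin k → ℝ, b₀ * ∑ a : Fin k, w a ^ 2 ≤ ∑ a : Fin k, ∑ a' : Fin k, w a * B a a' * w a') → ∀ (wt : TorusSite d N → Fin d → ℝ), (∀ (x : TorusSite d N) (i : Fin d), 0 ≤ wt x i ∧ wt x i ≤ 1) → (Matrix.of (fun p q : TorusSite d N × Fin k => (g ^ 2)⁻¹ * ((if p.1 = q.1 then (if p.2 = q.2 then ε + 2 * (d : ℝ) else 0) + B p.2 q.2 else 0) - (if p.2 = q.2 then ∑ i : Fin d, ((if q.1 = p.1 + Pi.single i 1 then wt p.1 i else 0) + (if q.1 = p.1 - Pi.single i 1 then wt (p.1 - Pi.single i 1) i else 0)) else 0)))).PosDef := by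
  intro d N k _ g ε b₀ hg hε hb₀ B hBsymm hB wt hwt
  classical
  refine Matrix.PosDef.of_dotProduct_mulVec_pos ?_ ?_
  · -- symmetry
    refine Matrix.IsHermitian.ext fun p q => ?_
    simp only [star_trivial, Matrix.of_apply]
    congr 1
    congr 1
    · by_cases h1 : q.1 = p.1
      · rw [if_pos h1, if_pos h1.symm, hBsymm q.2 p.2]
        by_cases h2 : q.2 = p.2
        · rw [if_pos h2, if_pos h2.symm]
        · rw [if_neg h2, if_neg (Ne.symm h2)]
      · rw [if_neg h1, if_neg (Ne.symm h1)]
    · by_cases h2 : q.2 = p.2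
      · rw [if_pos h2, if_pos h2.symm]
        refine Finset.sum_congr rfl fun i _ => ?_
        have e1 : (p.1 = q.1 + Pi.single i 1) ↔ (q.1 = p.1 - Pi.single i 1) := by
          constructor <;> intro h <;> rw [h] <;> abel
        have e2 : (p.1 = q.1 - Pi.single i 1) ↔ (q.1 = p.1 + Pi.single i 1) := by
          constructor <;> intro h <;> rw [h] <;> abel
        rw [add_comm]
        congr 1
        · by_cases h : p.1 = q.1 - Pi.single i 1
          · rw [if_pos h, if_pos (e2.1 h), h]
          · rw [if_neg h, if_neg (fun h' => h (e2.2 h'))]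
        · by_cases h : q.1 = p.1 - Pi.single i 1
          · rw [if_pos (e1.2 h), if_pos h, h]
          · rw [if_neg (fun h' => h (e1.1 h')), if_neg h]
      · rw [if_neg h2, if_neg (Ne.symm h2)]
  · -- positivity
    intro φ hφ
    simp only [star_trivial]
    have hcoer := weightedDebyeOp_coercive d N k ε b₀ hε B hB wt hwt (fun x a => φ (x, a))
    have hg2 : 0 < g ^ 2 := lt_of_le_of_ne (sq_nonneg g) (Ne.symm (pow_ne_zero 2 hg))
    -- `φᵀPφ = g⁻² ⟨u, L u⟩`
    have hPL : φ ⬝ᵥ (Matrix.of (fun p q : TorusSite d N × Fin k => (g ^ 2)⁻¹ * ((if p.1 = q.1 then (if p.2 = q.2 then ε + 2 * (d : ℝ) else 0) + B p.2 q.2 else 0) - (if p.2 = q.2 then ∑ i : Fin d, ((if q.1 = p.1 + Pi.single i 1 then wt p.1 i else 0) + (if q.1 = p.1 - Pi.single i 1 then wt (p.1 - Pi.single i 1) i else 0)) else 0))) *ᵥ φ) = (g ^ 2)⁻¹ * ∑ x : TorusSite d N, ∑ a : Fin k, φ (x, a) *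
        ((ε + 2 * d) * φ (x, a) + ∑ a' : Fin k, B a a' * φ (x, a') -
          ∑ i : Fin d, (wt x i * φ (x + Pi.single i 1, a) + wt (x - Pi.single i 1) i * φ (x - Pi.single i 1, a))) := by
      rw [dotProduct]
      simp_rw [weightedDhMatrix_mulVec d N k g ε B wt φ]
      rw [Finset.mul_sum, Fintype.sum_prod_type]
      refine Finset.sum_congr rfl fun x _ => ?_
      rw [Finset.mul_sum]
      refine Finset.sum_congr rfl fun a _ => ?_
      ring
    rw [hPL]
    have hpos : 0 < ∑ x : TorusSite d N, ∑ a : Fin k, φ (x, a) ^ 2 := by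
      rw [← Fintype.sum_prod_type (fun p : TorusSite d N × Fin k => φ p ^ 2)]
      obtain ⟨p, hp⟩ : ∃ p, φ p ≠ 0 := Function.ne_iff.1 hφ
      exact lt_of_lt_of_le (by positivity : 0 < φ p ^ 2)
        (Finset.single_le_sum (f := fun q => φ q ^ 2) (fun q _ => sq_nonneg _) (Finset.mem_univ p))
    have : 0 < ∑ x : TorusSite d N, ∑ a : Fin k, φ (x, a) *
        ((ε + 2 * d) * φ (x, a) + ∑ a' : Fin k, B a a' * φ (x, a') -
          ∑ i : Fin d, (wt x i * φ (x + Pi.single i 1, a) + wt (x - Pi.single i 1) i * φ (x - Pi.single i 1, a))) :=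
      lt_of_lt_of_le (mul_pos hb₀ hpos) hcoer
    positivity

/-- **Exponential decay of the bond-weighted Debye–Hückel covariance, uniform in the weights.**
For `g ≠ 0`, `ε ≥ 0`, `B` symmetric with `B ≥ b₀ > 0` and weights `0 ≤ w ≤ 1`,
`|P_w⁻¹((x,a),(y,a'))| ≤ (g²/b₀)(2d/(2d+b₀))^n` whenever `x_{i₀} − y_{i₀} ∉ {[z] : |z| < n}` — uniformly
in `N`, `ε`, and the weights, hence along every decoupling interpolation of the Debye–Hückel
Gaussian (`dhMatrix_blockInterpolate_eq_weighted`). [folklore] -/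
theorem weightedDhMatrix_inv_decay :
    ∀ (d N k : ℕ) [NeZero N] (g ε b₀ : ℝ), g ≠ 0 → 0 ≤ ε → 0 < b₀ → ∀ (B : Fin k → Fin k → ℝ), (∀ a a' : Fin k, B a a' = B a' a) → (∀ w : Fin k → ℝ, b₀ * ∑ a : Fin k, w a ^ 2 ≤ ∑ a : Fin k, ∑ a' : Fin k, w a * B a a' * w a') → ∀ (wt : TorusSite d N → Fin d → ℝ), (∀ (x : TorusSite d N) (i : Fin d), 0 ≤ wt x i ∧ wt x i ≤ 1) → ∀ (i₀ : Fin d) (n : ℕ) (x y : TorusSite d N) (a a' : Fin k), (∀ z : ℤ, |z| < n → x i₀ - y i₀ ≠ (z : ZMod N)) → |(Matrix.of (fun p q : TorusSite d N × Fin k => (g ^ 2)⁻¹ * ((if p.1 = q.1 then (if p.2 = q.2 then ε + 2 * (d : ℝ) else 0) + B p.2 q.2 else 0) - (if p.2 = q.2 then ∑ i : Fin d, ((if q.1 = p.1 + Pi.single i 1 then wt p.1 i else 0) + (if q.1 = p.1 - Pi.single i 1 then wt (p.1 - Pi.single i 1) i else 0)) else 0))))⁻¹ (x, a) (y, a')|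 ≤ g ^ 2 / b₀ * (2 * d / (2 * d + b₀)) ^ n := by
  intro d N k _ g ε b₀ hg hε hb₀ B hBsymm hB wt hwt i₀ n x y a a' hfar
  classical
  set P : Matrix (TorusSite d N × Fin k) (TorusSite d N × Fin k) ℝ := Matrix.of (fun p q : TorusSite d N × Fin k => (g ^ 2)⁻¹ * ((if p.1 = q.1 then (if p.2 = q.2 then ε + 2 * (d : ℝ) else 0) + B p.2 q.2 else 0) - (if p.2 = q.2 then ∑ i : Fin d, ((if q.1 = p.1 + Pi.single i 1 then wt p.1 i else 0) + (if q.1 = p.1 - Pi.single i 1 then wt (p.1 - Pi.single i 1) i else 0)) else 0))) with hPdef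
  have hP : P.PosDef := weightedDhMatrix_posDef d N k g ε b₀ hg hε hb₀ B hBsymm hB wt hwt
  have hg2 : 0 < g ^ 2 := lt_of_le_of_ne (sq_nonneg g) (Ne.symm (pow_ne_zero 2 hg))
  -- the column `(y, a')` of `P⁻¹`
  set u : TorusSite d N → Fin k → ℝ := fun x₁ a₁ => P⁻¹ (x₁, a₁) (y, a') with hu
  have hcol : P *ᵥ (fun q => P⁻¹ q (y, a')) = fun p => if p = (y, a') then 1 else 0 := by
    have hmul : P * P⁻¹ = 1 := Matrix.mul_nonsing_inv P
      ((Matrix.isUnit_iff_isUnit_det P).1 hP.isUnit)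
    funext p
    have := congrFun (congrFun hmul p) (y, a')
    rw [Matrix.mul_apply, Matrix.one_apply] at this
    rw [← this, Matrix.mulVec, dotProduct]
  -- hence `L u = δ_y ⊗ (g² e_{a'})`
  have hL : ∀ (x₁ : TorusSite d N) (a₁ : Fin k), (ε + 2 * d) * u x₁ a₁ + ∑ a₂ : Fin k, B a₁ a₂ * u x₁ a₂ -
      ∑ i : Fin d, (wt x₁ i * u (x₁ + Pi.single i 1) a₁ + wt (x₁ - Pi.single i 1) i * u (x₁ - Pi.single i 1) a₁) =
        if x₁ = y then (fun a₂ : Fin k => if a₂ = a' then g ^ 2 else 0) a₁ else 0 := by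
    intro x₁ a₁
    have h1 := congrFun hcol (x₁, a₁)
    rw [hPdef, weightedDhMatrix_mulVec d N k g ε B wt (fun q => P⁻¹ q (y, a')) (x₁, a₁)] at h1
    simp only [hu]
    have h2 : (ε + 2 * d) * P⁻¹ (x₁, a₁) (y, a') + ∑ a₂ : Fin k, B a₁ a₂ * P⁻¹ (x₁, a₂) (y, a') -
        ∑ i : Fin d, (wt x₁ i * P⁻¹ (x₁ + Pi.single i 1, a₁) (y, a') + wt (x₁ - Pi.single i 1) i * P⁻¹ (x₁ - Pi.single i 1, a₁) (y, a')) =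
        g ^ 2 * (if ((x₁, a₁) : TorusSite d N × Fin k) = (y, a') then 1 else 0) := by
      rw [← h1]
      field_simp
    rw [h2]
    by_cases hx : x₁ = y
    · by_cases ha : a₁ = a'
      · simp [hx, ha]
      · simp [hx, ha]
    · have : ((x₁, a₁) : TorusSite d N × Fin k) ≠ (y, a') := fun h => hx (Prod.mk.inj h).1
      simp [hx, this]
  have hdec := weightedDebyeGreen_decay d N k ε b₀ hε hb₀ B hB wt hwt y (fun a₂ => if a₂ = a' then g ^ 2 else 0) u hL i₀ n x hfar
  have hv : ∑ a₂ : Fin k, (if a₂ = a' then g ^ 2 else (0 : ℝ)) ^ 2 = (g ^ 2) ^ 2 := by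
    simp [Finset.sum_ite_eq', apply_ite (· ^ 2)]
  rw [hv] at hdec
  have hsingle : u x a ^ 2 ≤ ∑ a₂ : Fin k, u x a₂ ^ 2 :=
    Finset.single_le_sum (f := fun a₂ => u x a₂ ^ 2) (fun _ _ => sq_nonneg _) (Finset.mem_univ a)
  have hθ : 0 ≤ (2 * d / (2 * d + b₀) : ℝ) := by positivity
  have hbound : u x a ^ 2 ≤ (g ^ 2 / b₀ * (2 * d / (2 * d + b₀)) ^ n) ^ 2 := by
    calc u x a ^ 2 ≤ (g ^ 2) ^ 2 / b₀ ^ 2 * ((2 * d / (2 * d + b₀)) ^ 2) ^ n := hsingle.trans hdec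
      _ = (g ^ 2 / b₀ * (2 * d / (2 * d + b₀)) ^ n) ^ 2 := by
          rw [pow_right_comm (2 * (d : ℝ) / (2 * d + b₀)) 2 n]; ring
  have hnn : 0 ≤ g ^ 2 / b₀ * (2 * d / (2 * d + b₀)) ^ n := by positivity
  show |u x a| ≤ _
  exact abs_le.2 (abs_le_of_sq_le_sq' hbound hnn)


/-- **The decoupling interpolation of the Debye–Hückel matrix is a bond-weighted Debye–Hückel
matrix.** For a set `T` of sites, coordinates `S = T × Fin k`, the block-diagonal part `P_bd` of
the Debye–Hückel matrix `P` along `S ⊔ Sᶜ` and any `s`, `P_bd + s(P − P_bd)` is the weighted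
matrix with weight `1` on bonds inside `T` or inside `Tᶜ` and weight `s` on bonds crossing `∂T`
(entrywise: the site-diagonal part never crosses, a hopping entry is multiplied by `1` or `s`).
So `weightedDhMatrix_inv_decay` bounds the covariance at every stage of
`gaussian_decoupling_step` applied to the Debye–Hückel Gaussian, uniformly in `s ∈ [0,1]`.
[folklore] -/
theorem dhMatrix_blockInterpolate_eq_weighted :
    ∀ (d N k : ℕ) [NeZero N] (g ε : ℝ) (B : Fin k → Fin k → ℝ) (T : Finset (TorusSite d N)) (s : ℝ), let P : Matrix (TorusSite d N × Fin k) (TorusSite d N × Fin k) ℝ := Matrix.of (fun p q : TorusSite d N × Fin k => (g ^ 2)⁻¹ * ((if p.1 = q.1 then (if p.2 = q.2 then ε + 2 * (d : ℝ) else 0) + B p.2 q.2 else 0) - (if p.2 = q.2 then ∑ i : Fin d, ((if q.1 = p.1 + Pi.single i 1 then (1 : ℝ) else 0) + (if q.1 = p.1 - Pi.single i 1 then (1 : ℝ) else 0)) else 0))); let S : Finset (TorusSite d N × Fin k) := Finset.univ.filter (fun p => p.1 ∈ T); let Pbd : Matrix (TorusSite d N × Fin k) (TorusSite d N × Fin k)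 ℝ := Matrix.of fun p q : TorusSite d N × Fin k => if (p ∈ S ↔ q ∈ S) then P p q else 0; Pbd + s • (P - Pbd) = Matrix.of (fun p q : TorusSite d N × Fin k => (g ^ 2)⁻¹ * ((if p.1 = q.1 then (if p.2 = q.2 then ε + 2 * (d : ℝ) else 0) + B p.2 q.2 else 0) - (if p.2 = q.2 then ∑ i : Fin d, ((if q.1 = p.1 + Pi.single i 1 then (if (p.1 ∈ T ↔ p.1 + Pi.single i 1 ∈ T) then (1 : ℝ) else s) else 0) + (if q.1 = p.1 - Pi.single i 1 then (if (p.1 - Pi.single i 1 ∈ T ↔ p.1 - Pi.single i 1 + Pi.single i 1 ∈ T) then (1 : ℝ) else s) else 0)) else 0))) := by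
  intro d N k _ g ε B T s P S Pbd
  ext p q
  have hS : ∀ r : TorusSite d N × Fin k, r ∈ S ↔ r.1 ∈ T := fun r => by simp [S]
  set c : ℝ := if (p.1 ∈ T ↔ q.1 ∈ T) then 1 else s with hc
  -- left-hand side: `c · P p q`
  have hL : (Pbd + s • (P - Pbd)) p q = c * P p q := by
    simp only [Matrix.add_apply, Matrix.smul_apply, Matrix.sub_apply, smul_eq_mul, Pbd, Matrix.of_apply, hS]
    rw [hc]
    by_cases h : (p.1 ∈ T ↔ q.1 ∈ T)
    · rw [if_pos h, if_pos h]; ring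
    · rw [if_neg h, if_neg h]; ring
  rw [hL]
  simp only [P, Matrix.of_apply]
  -- the site-diagonal part never crosses `∂T`
  have hdiag : (if p.1 = q.1 then (if p.2 = q.2 then ε + 2 * (d : ℝ) else 0) + B p.2 q.2 else 0) =
      c * (if p.1 = q.1 then (if p.2 = q.2 then ε + 2 * (d : ℝ) else 0) + B p.2 q.2 else 0) := by
    by_cases h : p.1 = q.1
    · have hc1 : c = 1 := by rw [hc, if_pos (by rw [h])]
      rw [hc1, one_mul]
    · rw [if_neg h, mul_zero]
  -- a hopping entry is multiplied by `c`
  have hhop : ∀ i : Fin d,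
      ((if q.1 = p.1 + Pi.single i 1 then (if (p.1 ∈ T ↔ p.1 + Pi.single i 1 ∈ T) then (1 : ℝ) else s) else 0) +
        (if q.1 = p.1 - Pi.single i 1 then (if (p.1 - Pi.single i 1 ∈ T ↔ p.1 - Pi.single i 1 + Pi.single i 1 ∈ T) then (1 : ℝ) else s) else 0)) =
      c * ((if q.1 = p.1 + Pi.single i 1 then (1 : ℝ) else 0) + (if q.1 = p.1 - Pi.single i 1 then (1 : ℝ) else 0)) := by
    intro i
    rw [mul_add]
    congr 1
    · by_cases h : q.1 = p.1 + Pi.single i 1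
      · rw [if_pos h, if_pos h, mul_one, hc, ← h]
      · rw [if_neg h, if_neg h, mul_zero]
    · by_cases h : q.1 = p.1 - Pi.single i 1
      · rw [if_pos h, if_pos h, mul_one, hc, sub_add_cancel, ← h]
        by_cases h1 : (p.1 ∈ T ↔ q.1 ∈ T)
        · rw [if_pos h1, if_pos (iff_comm.1 h1)]
        · rw [if_neg h1, if_neg (fun h2 => h1 (iff_comm.1 h2))]
      · rw [if_neg h, if_neg h, mul_zero]
  rw [Finset.sum_congr rfl fun i _ => hhop i, ← Finset.mul_sum]
  conv_rhs => rw [hdiag]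
  by_cases h2 : p.2 = q.2
  · simp only [h2, ↓reduceIte]; ring
  · simp only [h2, ↓reduceIte]; ring

end Summit.QuantumFields.YangMills.Theorems.AnchorGap

end
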